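import Summits.QuantumFields.BalabanUV.Beta.EriceRemainderEnclosureHistoryAutonomyComparisonAgeCompositionStaticEndEnteringFreeEnd
import Summits.QuantumFields.BalabanUV.Beta.EriceRemainderEnclosureHistoryAutonomyComparisonAgeCompositionDecayHorizon
import Summits.QuantumFields.BalabanUV.Beta.EriceRemainderEnclosureHistoryAutonomyComparisonAgeCompositionEnteringLagFlow

/-!
# EriceRemainderEnclosureHistoryAutonomyComparisonAgeCompositionThreeAgesEntering — (E86h) route (N), first order: (E86g)'s END for the flow with the
# horizon freed, and THE THREE-AGE SOCKET ON THE ENTERING-LAG FAMILIES — the damped END for `{1, k₂, k₃}` modulo (S-b)₁, (S-a)∨(S-d) for `(1,k₂)` and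
# `(1,k₃)`, the tail sums ∨ (S-e″) for the middle age, (S-a) ∨ (S-h) for `(k₂,k₃)`, and (S-c♯) ∨ (M1) above the middle age

Cell `pub-balaban`, β-function sub-cell, BINDER row D4 «RemainderConst leaves for Bałaban's split» (`HOME/BINDER-OWNERS.md`; owner lineage `b2b-balaban-beta-an4`;
this file by co-owner #2 lineage `b2b-balaban-beta-d4-p2`, generation 77), β-FLOW TEAM duty (1), FREEZE (0) honoured (def-free; imports (E86g), (E86a),
(E83b); uses (E86g) `nonneg_of_static_families_entering_free`, (E86a) `sum_range_of_le` ∕ `aggregate_eq_zero_of_horizon`, (E83b) `flow_onelag_structure` ∕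
`flow_sigma_mem`, (E81d) `flow_cum_dom_of_rowmass`, (E82e) `silent_tail_sums`, (E82c) `kernel_zero` BY NAME; nothing restated).

HONEST FRAMING (page 1, verbatim and binding).  *"Discharging BetaPertH makes Bałaban's UV stability UNCONDITIONAL — a real constructive-QFT result; it is
NOT the continuum limit and NOT the Clay problem."*  THIS FILE DISCHARGES NOTHING OF THE KIND.  Elementary real analysis about ABSTRACT functionals on a box
]0,γ]^ℕ with displayed floors, profiles and signs, and the FIRST-ORDER renewal objects of route (N) built from them — hypotheses of a census, not facts; the
form, signs, ages and moments of Bałaban's (1.22) limit functional are NOT PRINTED ([I] p. 298; GAPS G-t4-U2-1∕-2) and NOT asserted.  Row D4 class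
UNCHANGED (critical-path width 0; instance 0∕1; D4 DISCHARGE NO DATE).  HONEST DEPENDENCY: continuum YM on T⁴ ⇐ BetaPertH ∧ nine spine estimates (0/9
proved); BetaPertH ⇐ (D1) ∧ (D4) ∧ CAP+tail; G-an2-4 gates asym, D1 and NE2/3/4.

THE POINT (census sense (α); route (N); README `HOME/b2b-balaban-beta-d4-p2/g77/e86/README.md` §4).  §1 **`flow_nonneg_of_static_families_entering_horizon`**:
(E86a) `flow_nonneg_of_static_families_decay_horizon` on (E86g) `nonneg_of_static_families_entering_free` — the one-lag structure `σ k m = 1 − θ k m 1` is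
(E83b) `flow_onelag_structure` ∕ `flow_sigma_mem`; the four-way per-level option, the four-way per-pair option (young lower masses `AL`, displayed) and the
top option `hM1opt` are passed through; horizon `N ≥ K`.  §2 **`flow_nonneg_three_ages_entering_horizon`**: the THREE-AGE SOCKET v2 (compare (E86b)
`flow_nonneg_three_ages_horizon`): loaded ages `{1,k₂,k₃}`, `2 ≤ k₂ < k₃`, `K = k₃+1`, every damping of the relaxed class, every horizon `N ≥ K`; DISPLAYED:
`hSb1` ((S-b)₁), `hpair12` ((S-a)_{k₂} ∨ (S-d)(1,k₂)), `hpair13` ((S-a)_{k₃} ∨ (S-d)(1,k₃)), `hlev2` (the tail sums of the middle age ∨ **(S-e″)_{k₂}**),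
`hpair23` ((S-a)_{k₃} ∨ **(S-h)_{(k₂,k₃)}**), `hM1top` (**(S-c♯) above k₂ ∨ (M1) of the top surplus directly**).  Census g77 (`g77/numerics/t3job`; benchmark
three-age flows `k₃ ≤ 128`, classes one∕self∕lower∕adversarial-relaxed): the SECOND member of every disjunction has a k-uniform margin — (S-d) `≤ −0.017`
(ratio `≈ −2∕k₃`·… no: log-ratio `−0.017 … −0.49`), (S-e″) `−0.055 … −0.25`, (S-h) `−0.2 … −1.9`, (E83a)'s top criterion (the flow form of the direct (M1))
`−0.2 … −0.96` — while (S-b)_{k₂} FAILS (`+0.0025`) and (S-a)_{k₃}, (S-c♯) sit at `≈ −0.4∕k₃`.  NOT CLAIMED: any family along flows ((S-b)₁ is (E82c)'s for TWO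
ages only); four or more loaded ages; anything nonlinear; anything printed — NOT B12 Thm 2, NOT BetaPertH.

§3 **`flow_M1_top_of_crit`**: the second member of `hM1top` from the STATIC family (S-f) = (E83a)'s criterion for the oldest age along the flow ((E83a)
`mono2_top_of_onelag` + (E83b)'s flow facts; the surplus above `k₂` is the lone solve of `KL k₃`).  §4 **`flow_nonneg_three_ages_entering_static`**: the
socket v3 — every displayed disjunction's second member a STATIC family: (S-d), (S-e″), (S-h), (S-f).

WHAT IS PROVED ([folklore]; 0 `def`, 0 sorry).  §1 **`flow_nonneg_of_static_families_entering_horizon`**; §2 **`flow_nonneg_three_ages_entering_horizon`**;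
§3 **`flow_M1_top_of_crit`**; §4 **`flow_nonneg_three_ages_entering_static`**.
-/
noncomputable section
open Finset

namespace Summit.QuantumFields.BalabanUV.Beta.EriceRemainderEnclosureHistoryAutonomyComparisonAgeCompositionThreeAgesEntering

open Literature.MathematicalPhysics.QuantumFieldTheory.Balaban1983to89
open Literature.MathematicalPhysics.QuantumFieldTheory.Balaban1983to89.T4BetaStationary
open Literature.MathematicalPhysics.QuantumFieldTheory.Balaban1983to89.T4BetaFlowWellPosed
open Summit.QuantumFields.BalabanUV.Beta.EriceRemainderEnclosureHistoryAutonomyOrder (strictAnti_of_memFlow)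
open Summit.QuantumFields.BalabanUV.Beta.EriceRemainderEnclosureHistoryAutonomyComparisonAgeCompositionIdentification
open Summit.QuantumFields.BalabanUV.Beta.EriceRemainderEnclosureHistoryAutonomyComparisonAgeCompositionChainWiringAtPin (age_chain_closes)
open Summit.QuantumFields.BalabanUV.Beta.EriceRemainderEnclosureHistoryAutonomyComparisonAgeCompositionCriteriaFlow (flow_shift_domination flow_cum_dom_of_rowmass)
open Summit.QuantumFields.BalabanUV.Beta.EriceRemainderEnclosureHistoryAutonomyComparisonAgeCompositionStaticEndFlow (flow_lag_zero_mass_lt_one)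
open Summit.QuantumFields.BalabanUV.Beta.EriceRemainderEnclosureHistoryAutonomyComparisonAgeCompositionStaticEndOldestFlow (silent_tail_sums)
open Summit.QuantumFields.BalabanUV.Beta.EriceRemainderEnclosureHistoryAutonomyComparisonAgeCompositionYoungestTailSumWiring (kernel_zero)
open Summit.QuantumFields.BalabanUV.Beta.EriceRemainderEnclosureHistoryAutonomyComparisonAgeCompositionEnteringLagFlow
  (flow_onelag_structure flow_sigma_mem flow_onelag_decay flow_trunc_key)
open Summit.QuantumFields.BalabanUV.Beta.EriceRemainderEnclosureHistoryAutonomyComparisonAgeCompositionEnteringLag (mono2_top_of_onelag)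
open Summit.QuantumFields.BalabanUV.Beta.EriceRemainderEnclosureHistoryAutonomyComparisonAgeComposition (sol_unique)
open Summit.QuantumFields.BalabanUV.Beta.EriceRemainderEnclosureHistoryAutonomyComparisonAgeCompositionChainWiring (aggregate_eq_sum)
open Summit.QuantumFields.BalabanUV.Beta.EriceRemainderEnclosureHistoryAutonomyComparisonAgeCompositionStaticEnd (truncation_admissible)
open Summit.QuantumFields.BalabanUV.Beta.EriceRemainderEnclosureHistoryAutonomyComparisonAgeCompositionDecayHorizon (sum_range_of_le aggregate_eq_zero_of_horizon)
open Summit.QuantumFields.BalabanUV.Beta.EriceRemainderEnclosureHistoryAutonomyComparisonAgeCompositionStaticEndEnteringFreeEnd (nonneg_of_static_families_entering_free)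

variable {B : (ℕ → ℝ) → ℝ} {γ b gIR : ℝ} {L : ℕ → ℝ} {K : ℕ} {h g : ℕ → ℝ} {KL : ℕ → ℕ → ℕ → ℝ}

/-! ## §1 (E86g)'s END for the flow, general horizon -/

/-- **ROUTE (N), FIRST ORDER, END FOR THE FLOW — ENTERING-LAG OPTIONS, GENERAL HORIZON.**  As (E86a) `flow_nonneg_of_static_families_decay_horizon` on
(E86g) `nonneg_of_static_families_entering_free`: the one-lag structure of the flow's lone kernels is `σ k m = 1 − θ k m 1` ((E83b)); per level `i < K−1` the
four-way option `hlev` (one lag ∧ (S-b)ᵢ at `L′=0` ∣ silent ∣ `P(i+1)` ∧ tail sums ∣ (S-e″)ᵢ); per pair the four-way option `hMONOopt` (cumulative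
domination ∣ silent ∣ one lag ∧ (S-d) ∣ `P(i+1)` ∧ (S-h) with the young lower masses `AL`); per `P`-level the top option `hM1opt` ((S-c♯) ∣ (M1)
directly). [folklore] -/
theorem flow_nonneg_of_static_families_entering_horizon (hmono : ∀ u v : ℕ → ℝ, SeqBox γ u → SeqBox γ v → (∀ j, u j ≤ v j) → B u ≤ B v)
    (hL : ∀ k, 0 ≤ L k) (hb : 0 < b) (hlo : ∀ u, SeqBox γ u → b ≤ B u) (hdom : ∀ u, SeqBox γ u → ∑ k ∈ range K, L k * u k ≤ B u)
    (hh : SeqBox γ h) (hf : MemFlow B gIR h)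
    (hg : ∀ t, 0 < g t ∧ g t ≤ 1) (hgF : ∀ t, 1 / (1 + ∑ k ∈ range K, L k * h (t + k) ^ 3 / 2) ≤ g t) (hK : 2 ≤ K) {N : ℕ} (hKN : K ≤ N)
    (hKL : ∀ k n l, KL k n l = if 0 < k ∧ k < K ∧ l < k then L k * h (n + k) ^ 3 / 2 * ∏ t ∈ Ico (n + 1 + l) (n + k + 1), g t else 0)
    {θ : ℕ → ℕ → ℕ → ℝ} (hθ : ∀ k n l, θ k n l = 1 - (h (n + k + l) / h (n + k)) ^ 3 * ∏ t ∈ Ico (n + k + 1) (n + k + l + 1), g t)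
    {KA : ℕ → ℕ → ℕ → ℝ} {RL RA SL SA : ℕ → (ℕ → ℝ) → ℕ → ℝ}
    (hRL : ∀ i v m, RL i v m = ∑ l ∈ range K, KL i m l * v (m + 1 + l))
    (hRA : ∀ i v m, RA i v m = ∑ l ∈ range K, KA i m l * v (m + 1 + l))
    (hKA : ∀ i m l, KA i m l = KL i m l + KA (i + 1) m l) (hKAtop : ∀ m l, KA K m l = 0)
    (hSL : ∀ i (w : ℕ → ℝ), (∀ m, N < m → w m = 0) → (∀ m, N < m → SL i w m = 0) ∧ ∀ m, SL i w m = w m - RL i (SL i w) m)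
    (hSA : ∀ i (w : ℕ → ℝ), (∀ m, N < m → w m = 0) → (∀ m, N < m → SA i w m = 0) ∧ ∀ m, SA i w m = w m - RA i (SA i w) m)
    {ρ : ℕ → ℕ → ℝ} {β : ℕ → ℕ → ℕ → ℝ}
    (hρ : ∀ i n, 1 ≤ i → i ≤ K - 1 → ρ i n = (∑ l ∈ range K, KL i n l) * (1 + ∑ k ∈ Ioc i (K - 1), θ k n i * β (i + 1) n k) /
      (1 - ∑ k ∈ Ioc i (K - 1), ∑ l ∈ range i, KL k n l))
    (hβnew : ∀ i n, 1 ≤ i → i ≤ K - 1 → β i n i = ρ i n / (1 - ρ i n))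
    (hβold : ∀ i n k, 1 ≤ i → i < k → k ≤ K - 1 → β i n k = β (i + 1) n k / (1 - ρ i n))
    {Hg : ℕ → ℕ → ℝ} (hH : ∀ i m, Hg i m = (1 + ∑ k ∈ Ioc i (K - 1), θ k m 1 * β (i + 1) m k) / (1 - ∑ k ∈ Ioc i (K - 1), KL k m 0))
    {AL : ℕ → ℕ → ℕ → ℝ} (hAL : ∀ i j p, AL i j p = ∑ l ∈ range i, if p + 1 + l ≤ j then KL i p l * (1 - ρ i (p + 1 + l)) else 0)
    {P : ℕ → Prop}
    (hMONOopt : ∀ i k, 1 ≤ i → i < k → k ≤ K - 1 →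
      (∀ m M', ∑ l ∈ range (M' + 1), KL k (m + 1) l ≤ ∑ l ∈ range (M' + 2), KL k m l) ∨ (∀ m l, KL i m l = 0) ∨
      (i = 1 ∧ ∀ m, KL k (m + 1) (k - 1) * KL i (m + 1 + k) 0 * ∏ p ∈ Ico (m + 2) (m + 2 + k), Hg i p ≤
        KL k m 0 * KL i (m + 1) 0 * (1 - KL i (m + 2) 0 * Hg i (m + 2))) ∨
      (P (i + 1) ∧ ∀ j m, m + 1 + k ≤ j →
        KL k (m + 1) (k - 1) * ∑ l ∈ range i, KL i (m + 1 + k) l * ∏ s ∈ Ico (m + 2) (m + 2 + k + l), Hg i s ≤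
          (1 - (1 - θ k m 1)) * ∑ l' ∈ range k, KL k m l' * AL i j (m + 1 + l') + (1 - θ k m 1) * (KL k m 0 * AL i j (m + 1))))
    {M : ℕ → ℕ → ℝ} (hM : ∀ i m, M i m = KL i m 0 + ∑ l ∈ range (K - 1), max (KL i m (l + 1) - KL i (m + 1) l) 0)
    {HgS : ℕ → ℕ → ℕ → ℝ} (hHS : ∀ i j m, HgS i j m = (1 + ∑ k ∈ Ioc i (K - 1), θ k m 1 * β (i + 1) m k) /
      (1 - ∑ k ∈ Ioc i (K - 1), (KL k m 0 - if m + 1 + k ≤ j then KL k (m + 1) (k - 1) else 0)))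
    (hlev : ∀ i, 1 ≤ i → i < K - 1 →
      (i = 1 ∧ ∀ m, (1 + M i m) * (Hg i (m + 1) * KL i (m + 1) 0) ≤ KL i m 0) ∨ (∀ m l, KL i m l = 0) ∨
      (P (i + 1) ∧ (∀ m L', L' < i → (1 + M i m) * ∑ l ∈ Ico L' i, Hg i (m + 1 + l) * KL i (m + 1) l ≤ ∑ l ∈ Ico L' i, KL i m l) ∧
        (∀ m L₀, L₀ < i → ∀ L', L' ≤ L₀ → (1 + M i m) * ∑ l ∈ Ico L' L₀, Hg i (m + 1 + l) * KL i (m + 1) l ≤ ∑ l ∈ Ico L' (L₀ + 1), KL i m l)) ∨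
      (∀ m, KL i (m + 1) (i - 1) ≤ (1 - (1 - θ i m 1)) * ∑ l ∈ range i, KL i m l * (1 - ρ i (m + 1 + l)) / ∏ p ∈ Ico (m + 1 + l) (m + 1 + i), Hg i p +
        (1 - θ i m 1) * (KL i m 0 * (1 - ρ i (m + 1)) / ∏ p ∈ Ico (m + 1) (m + 1 + i), Hg i p)))
    (hM1opt : ∀ i, 1 ≤ i → i ≤ K - 1 → P i →
      ((∀ m j, m + 1 + N ≤ j → ∀ L', L' < N → ∑ l ∈ Ico L' N, HgS (i - 1) j (m + 1 + l) * KA i (m + 1) l ≤ ∑ l ∈ Ico L' N, KA i m l) ∧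
       (∀ m L₀, L₀ < N → ∀ L', L' ≤ L₀ → ∑ l ∈ Ico L' L₀, HgS (i - 1) (m + 1 + L₀) (m + 1 + l) * KA i (m + 1) l ≤ ∑ l ∈ Ico L' (L₀ + 1), KA i m l)) ∨
      (∀ j, j ≤ N → ∀ m, m < j → SA i (fun m => if m ≤ j then (1:ℝ) else 0) m ≤ SA i (fun m => if m ≤ j then (1:ℝ) else 0) (m + 1)))
    {e ε : ℕ → ℝ} (he0 : ∀ m, 0 ≤ e m) (hea : ∀ m, e (m + 1) ≤ e m) (het : ∀ m, N < m → e m = 0)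
    (hεt : ∀ m, N < m → ε m = 0) (hεrec : ∀ m, ε m = e m - RA 1 ε m) : ∀ m, 0 ≤ ε m := by
  have hh0 : ∀ n, 0 < h n := fun n => (hh n).1
  have hanti := (strictAnti_of_memFlow hb hlo hh hf).antitone
  have hac := fun n i (hi1 : 1 ≤ i) (hiK : i ≤ K - 1) =>
    age_chain_closes hmono hL hb hlo hdom hh hf hg hgF hKL hθ hρ hβnew hβold n hi1 hiK
  have hKLK : ∀ i m l, K ≤ l + 1 → KL i m l = 0 := fun i m l hl => by rw [hKL, if_neg (by omega)]
  have hKLtop : ∀ i m l, K ≤ i → KL i m l = 0 := fun i m l hi => by rw [hKL, if_neg (by omega)]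
  have hKA0 : ∀ i m l, K ≤ l → KA i m l = 0 :=
    aggregate_eq_zero_of_horizon hKA hKAtop (fun i m l hl => hKLK i m l (by omega)) hKLtop
  have hRL' : ∀ i v m, RL i v m = ∑ l ∈ range N, KL i m l * v (m + 1 + l) := fun i v m => by
    rw [hRL]; exact sum_range_of_le hKN fun l hl => by rw [hKLK i m l (by omega), zero_mul]
  have hRA' : ∀ i v m, RA i v m = ∑ l ∈ range N, KA i m l * v (m + 1 + l) := fun i v m => by
    rw [hRA]; exact sum_range_of_le hKN fun l hl => by rw [hKA0 i m l hl, zero_mul]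
  have hρ' : ∀ i n, 1 ≤ i → i ≤ K - 1 → ρ i n = (∑ l ∈ range N, KL i n l) * (1 + ∑ k ∈ Ioc i (K - 1), θ k n i * β (i + 1) n k) /
      (1 - ∑ k ∈ Ioc i (K - 1), ∑ l ∈ range i, KL k n l) := fun i n hi1 hiK => by
    rw [hρ i n hi1 hiK, sum_range_of_le hKN fun l hl => hKLK i n l (by omega)]
  have hM' : ∀ i m, M i m = KL i m 0 + ∑ l ∈ range (N - 1), max (KL i m (l + 1) - KL i (m + 1) l) 0 := fun i m => by
    rw [hM, sum_range_of_le (show K - 1 ≤ N - 1 by omega) fun l hl => by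
      rw [hKLK i m (l + 1) (by omega), hKLK i (m + 1) l (by omega), sub_zero, max_self]]
  exact nonneg_of_static_families_entering_free (N := N) (n := K - 1) (y := fun i => i) (KL := KL) (θ := θ) (σ := fun k m => 1 - θ k m 1)
    (weight_nonneg hL hh0 hg hKL) (fun i m l hl => hKLK i m l (by omega))
    (fun i m l hl => by rw [hKL, if_neg (fun h3 => by omega)])
    hRL' hRA' hKA (fun m l => by rw [Nat.sub_add_cancel (by omega : 1 ≤ K)]; exact hKAtop m l) hSL hSA
    (fun i hi1 hiK => ⟨hi1, by omega⟩)
    (defect_nonneg hh0 hanti hg hθ) (persistence hL hh0 hg hKL hθ) (fun k m l l' hll' => defect_mono hh0 hanti hg hθ k m hll')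
    hρ' hβnew hβold (fun i m hi1 hiK => (hac m i hi1 hiK).2) (fun i m hi1 hiK => (hac m i hi1 hiK).1)
    (fun k m l hl => flow_shift_domination hL hh0 hanti hg hKL k m l hl)
    (fun i m _ => flow_lag_zero_mass_lt_one hmono hL hb hlo hdom hh hf hg hKL i m) hH
    (fun k m l hl => flow_onelag_structure hh hKL hθ k m l hl) (fun k m => ⟨(flow_sigma_mem hh hanti hg hθ k m).1.le, (flow_sigma_mem hh hanti hg hθ k m).2⟩)
    hAL hMONOopt hM' hHS hlev hM1opt he0 hea het hεt hεrec

/-! ## §2 The three-age socket on the entering-lag families -/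

/-- **ROUTE (N), FIRST ORDER — THE THREE-AGE SOCKET v2: THE DAMPED END FOR `{1, k₂, k₃}` ON THE ENTERING-LAG FAMILIES, EVERY HORIZON, EVERY DAMPING OF THE
RELAXED CLASS.**  `2 ≤ k₂ < k₃`, `K = k₃ + 1`, `L_j = 0` for `j ∉ {1, k₂, k₃}`; `h` a box solution of an isotone memory `B` with floor `b > 0` dominated by
`L ≥ 0`; `g` any damping with `1∕(1+F_t) ≤ g_t ≤ 1`; horizon `N ≥ K`; the first-order objects of route (N) as displayed.  DISPLAYED HYPOTHESES (each a
disjunction; the second member is the generation-77 family with a k-uniform margin in the census): `hSb1` ((S-b) at the age 1, three-age growth), `hpair12`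
((S-a)_{k₂} ∨ (S-d)(1,k₂)), `hpair13` ((S-a)_{k₃} ∨ (S-d)(1,k₃)), `hlev2` (tail sums of the middle age ∨ (S-e″)_{k₂}), `hpair23` ((S-a)_{k₃} ∨ (S-h)_{(k₂,k₃)}),
`hM1top` ((S-c♯) above `k₂` ∨ (M1) of the top truncation surpluses).  CONCLUSION: `ε ≥ 0` at every pin for every admissible excess `e`. [folklore] -/
theorem flow_nonneg_three_ages_entering_horizon (hmono : ∀ u v : ℕ → ℝ, SeqBox γ u → SeqBox γ v → (∀ j, u j ≤ v j) → B u ≤ B v)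
    (hL : ∀ k, 0 ≤ L k) (hb : 0 < b) (hlo : ∀ u, SeqBox γ u → b ≤ B u) (hdom : ∀ u, SeqBox γ u → ∑ k ∈ range K, L k * u k ≤ B u)
    (hh : SeqBox γ h) (hf : MemFlow B gIR h)
    (hg : ∀ t, 0 < g t ∧ g t ≤ 1) (hgF : ∀ t, 1 / (1 + ∑ k ∈ range K, L k * h (t + k) ^ 3 / 2) ≤ g t)
    {k₂ k₃ : ℕ} (hk2 : 2 ≤ k₂) (hk23 : k₂ < k₃) (hKk : K = k₃ + 1) (hL3 : ∀ j, j < K → j ≠ 1 → j ≠ k₂ → j ≠ k₃ → L j = 0) {N : ℕ} (hKN : K ≤ N)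
    (hKL : ∀ k n l, KL k n l = if 0 < k ∧ k < K ∧ l < k then L k * h (n + k) ^ 3 / 2 * ∏ t ∈ Ico (n + 1 + l) (n + k + 1), g t else 0)
    {θ : ℕ → ℕ → ℕ → ℝ} (hθ : ∀ k n l, θ k n l = 1 - (h (n + k + l) / h (n + k)) ^ 3 * ∏ t ∈ Ico (n + k + 1) (n + k + l + 1), g t)
    {KA : ℕ → ℕ → ℕ → ℝ} {RL RA SL SA : ℕ → (ℕ → ℝ) → ℕ → ℝ}
    (hRL : ∀ i v m, RL i v m = ∑ l ∈ range K, KL i m l * v (m + 1 + l))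
    (hRA : ∀ i v m, RA i v m = ∑ l ∈ range K, KA i m l * v (m + 1 + l))
    (hKA : ∀ i m l, KA i m l = KL i m l + KA (i + 1) m l) (hKAtop : ∀ m l, KA K m l = 0)
    (hSL : ∀ i (w : ℕ → ℝ), (∀ m, N < m → w m = 0) → (∀ m, N < m → SL i w m = 0) ∧ ∀ m, SL i w m = w m - RL i (SL i w) m)
    (hSA : ∀ i (w : ℕ → ℝ), (∀ m, N < m → w m = 0) → (∀ m, N < m → SA i w m = 0) ∧ ∀ m, SA i w m = w m - RA i (SA i w) m)
    {ρ : ℕ → ℕ → ℝ} {β : ℕ → ℕ → ℕ → ℝ}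
    (hρ : ∀ i n, 1 ≤ i → i ≤ K - 1 → ρ i n = (∑ l ∈ range K, KL i n l) * (1 + ∑ k ∈ Ioc i (K - 1), θ k n i * β (i + 1) n k) /
      (1 - ∑ k ∈ Ioc i (K - 1), ∑ l ∈ range i, KL k n l))
    (hβnew : ∀ i n, 1 ≤ i → i ≤ K - 1 → β i n i = ρ i n / (1 - ρ i n))
    (hβold : ∀ i n k, 1 ≤ i → i < k → k ≤ K - 1 → β i n k = β (i + 1) n k / (1 - ρ i n))
    {Hg : ℕ → ℕ → ℝ} (hH : ∀ i m, Hg i m = (1 + ∑ k ∈ Ioc i (K - 1), θ k m 1 * β (i + 1) m k) / (1 - ∑ k ∈ Ioc i (K - 1), KL k m 0))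
    {AL : ℕ → ℕ → ℕ → ℝ} (hAL : ∀ i j p, AL i j p = ∑ l ∈ range i, if p + 1 + l ≤ j then KL i p l * (1 - ρ i (p + 1 + l)) else 0)
    {M : ℕ → ℕ → ℝ} (hM : ∀ i m, M i m = KL i m 0 + ∑ l ∈ range (K - 1), max (KL i m (l + 1) - KL i (m + 1) l) 0)
    {HgS : ℕ → ℕ → ℕ → ℝ} (hHS : ∀ i j m, HgS i j m = (1 + ∑ k ∈ Ioc i (K - 1), θ k m 1 * β (i + 1) m k) /
      (1 - ∑ k ∈ Ioc i (K - 1), (KL k m 0 - if m + 1 + k ≤ j then KL k (m + 1) (k - 1) else 0)))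
    -- THE DISPLAYED FAMILIES
    (hSb1 : ∀ m, (1 + M 1 m) * (Hg 1 (m + 1) * KL 1 (m + 1) 0) ≤ KL 1 m 0)
    (hpair12 : (∀ n, ∑ l ∈ range k₂, KL k₂ (n + 1) l ≤ ∑ l ∈ range k₂, KL k₂ n l) ∨
      (∀ m, KL k₂ (m + 1) (k₂ - 1) * KL 1 (m + 1 + k₂) 0 * ∏ p ∈ Ico (m + 2) (m + 2 + k₂), Hg 1 p ≤
        KL k₂ m 0 * KL 1 (m + 1) 0 * (1 - KL 1 (m + 2) 0 * Hg 1 (m + 2))))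
    (hpair13 : (∀ n, ∑ l ∈ range k₃, KL k₃ (n + 1) l ≤ ∑ l ∈ range k₃, KL k₃ n l) ∨
      (∀ m, KL k₃ (m + 1) (k₃ - 1) * KL 1 (m + 1 + k₃) 0 * ∏ p ∈ Ico (m + 2) (m + 2 + k₃), Hg 1 p ≤
        KL k₃ m 0 * KL 1 (m + 1) 0 * (1 - KL 1 (m + 2) 0 * Hg 1 (m + 2))))
    (hlev2 : ((∀ m L', L' < k₂ → (1 + M k₂ m) * ∑ l ∈ Ico L' k₂, Hg k₂ (m + 1 + l) * KL k₂ (m + 1) l ≤ ∑ l ∈ Ico L' k₂, KL k₂ m l) ∧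
        (∀ m L₀, L₀ < k₂ → ∀ L', L' ≤ L₀ → (1 + M k₂ m) * ∑ l ∈ Ico L' L₀, Hg k₂ (m + 1 + l) * KL k₂ (m + 1) l ≤ ∑ l ∈ Ico L' (L₀ + 1), KL k₂ m l)) ∨
      (∀ m, KL k₂ (m + 1) (k₂ - 1) ≤ (1 - (1 - θ k₂ m 1)) * ∑ l ∈ range k₂, KL k₂ m l * (1 - ρ k₂ (m + 1 + l)) / ∏ p ∈ Ico (m + 1 + l) (m + 1 + k₂), Hg k₂ p +
        (1 - θ k₂ m 1) * (KL k₂ m 0 * (1 - ρ k₂ (m + 1)) / ∏ p ∈ Ico (m + 1) (m + 1 + k₂), Hg k₂ p)))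
    (hpair23 : (∀ n, ∑ l ∈ range k₃, KL k₃ (n + 1) l ≤ ∑ l ∈ range k₃, KL k₃ n l) ∨
      (∀ j m, m + 1 + k₃ ≤ j →
        KL k₃ (m + 1) (k₃ - 1) * ∑ l ∈ range k₂, KL k₂ (m + 1 + k₃) l * ∏ s ∈ Ico (m + 2) (m + 2 + k₃ + l), Hg k₂ s ≤
          (1 - (1 - θ k₃ m 1)) * ∑ l' ∈ range k₃, KL k₃ m l' * AL k₂ j (m + 1 + l') + (1 - θ k₃ m 1) * (KL k₃ m 0 * AL k₂ j (m + 1))))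
    (hM1top : ((∀ m j, m + 1 + N ≤ j → ∀ L', L' < N →
          ∑ l ∈ Ico L' N, HgS k₂ j (m + 1 + l) * KA (k₂ + 1) (m + 1) l ≤ ∑ l ∈ Ico L' N, KA (k₂ + 1) m l) ∧
        (∀ m L₀, L₀ < N → ∀ L', L' ≤ L₀ →
          ∑ l ∈ Ico L' L₀, HgS k₂ (m + 1 + L₀) (m + 1 + l) * KA (k₂ + 1) (m + 1) l ≤ ∑ l ∈ Ico L' (L₀ + 1), KA (k₂ + 1) m l)) ∨
      (∀ j, j ≤ N → ∀ m, m < j →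
        SA (k₂ + 1) (fun m => if m ≤ j then (1:ℝ) else 0) m ≤ SA (k₂ + 1) (fun m => if m ≤ j then (1:ℝ) else 0) (m + 1)))
    {e ε : ℕ → ℝ} (he0 : ∀ m, 0 ≤ e m) (hea : ∀ m, e (m + 1) ≤ e m) (het : ∀ m, N < m → e m = 0)
    (hεt : ∀ m, N < m → ε m = 0) (hεrec : ∀ m, ε m = e m - RA 1 ε m) : ∀ m, 0 ≤ ε m := by
  have hh0 : ∀ n, 0 < h n := fun n => (hh n).1
  have hanti := (strictAnti_of_memFlow hb hlo hh hf).antitone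
  have hKL0 := weight_nonneg hL hh0 hg hKL
  have hsil : ∀ j, j < K → j ≠ 1 → j ≠ k₂ → j ≠ k₃ → ∀ n l, KL j n l = 0 := fun j hj h1 h2 h3 n l => kernel_zero hKL (hL3 j hj h1 h2 h3) n l
  have hcd := fun {k : ℕ} (hrow : ∀ n, ∑ l ∈ range k, KL k (n + 1) l ≤ ∑ l ∈ range k, KL k n l) (m M' : ℕ) =>
    flow_cum_dom_of_rowmass hL hh0 hanti hg hKL hrow m M'
  refine flow_nonneg_of_static_families_entering_horizon hmono hL hb hlo hdom hh hf hg hgF (by omega) hKN hKL hθ hRL hRA hKA hKAtop hSL hSA hρ hβnew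
    hβold hH hAL (P := fun i => i = k₂ + 1) (fun i k' hi1 hik' hk'K => ?_) hM hHS (fun i hi1 hiK => ?_) (fun i hi1 hiK hP => ?_) he0 hea het hεt hεrec
  · -- the pairs: k' = k₃ (`hpair13` for i = 1, `hpair23` for i = k₂, silent i otherwise); k' = k₂ (`hpair12` or silent i); k' silent
    by_cases hk3 : k' = k₃
    · subst hk3
      rcases Nat.lt_or_ge i 2 with hi | hi
      · rcases hpair13 with hrow | hSd
        · exact Or.inl (hcd hrow)
        · exact Or.inr (Or.inr (Or.inl ⟨by omega, by rw [show i = 1 by omega]; exact hSd⟩))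
      · by_cases hi2 : i = k₂
        · subst hi2
          rcases hpair23 with hrow | hSh
          · exact Or.inl (hcd hrow)
          · exact Or.inr (Or.inr (Or.inr ⟨rfl, hSh⟩))
        · exact Or.inr (Or.inl (hsil i (by omega) (by omega) hi2 (by omega)))
    by_cases hk2' : k' = k₂
    · subst hk2'
      rcases Nat.lt_or_ge i 2 with hi | hi
      · rcases hpair12 with hrow | hSd
        · exact Or.inl (hcd hrow)
        · exact Or.inr (Or.inr (Or.inl ⟨by omega, by rw [show i = 1 by omega]; exact hSd⟩))
      · exact Or.inr (Or.inl (hsil i (by omega) (by omega) (by omega) (by omega)))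
    · refine Or.inl fun m M' => ?_
      have hz := hsil k' (by omega) (by omega) hk2' hk3
      rw [sum_eq_zero fun l _ => hz _ _, sum_eq_zero fun l _ => hz _ _]
  · -- the levels: 1 is one-lag with `hSb1`; k₂ by `hlev2`; the rest are silent
    by_cases hi2 : i = k₂
    · subst hi2
      rcases hlev2 with hTS | hSe
      · exact Or.inr (Or.inr (Or.inl ⟨rfl, hTS⟩))
      · exact Or.inr (Or.inr (Or.inr hSe))
    rcases Nat.lt_or_ge i 2 with hi | hi
    · obtain rfl : i = 1 := by omega
      exact Or.inl ⟨rfl, hSb1⟩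
    · exact Or.inr (Or.inl (hsil i (by omega) (by omega) hi2 (by omega)))
  · -- the top option, only at the `P`-level `i = k₂ + 1`
    subst hP; rw [Nat.add_sub_cancel]; exact hM1top

/-! ## §3 The top (M1) along the flow from (E83a)'s entering-lag criterion -/

/-- **THE DIRECT (M1) ABOVE THE MIDDLE AGE, FROM (E83a)'s CRITERION FOR THE OLDEST AGE.**  Three loaded ages `{1,k₂,k₃}` (`K = k₃+1`, the levels between
`k₂` and `k₃` silent), horizon `N ≥ K`.  The surplus of the ages above `k₂` is the lone solve of the oldest kernel (`KA (k₂+1) = KL k₃`), so (E83a)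
`mono2_top_of_onelag` — with the flow facts `σ = 1 − θ_{k₃}(m;1) ∈ ]0,1]` ((E83b) `flow_onelag_structure`∕`flow_sigma_mem`), `σ(1 + KL k₃ m 0) ≤ 1`
((E83b) `flow_onelag_decay`), KEY for truncations ((E83b) `flow_trunc_key`) — turns the STATIC family **(S-f)**
`KL k₃ (m+1)(k₃−1) − (1−θ_{k₃}(m;1))·KL k₃ m 0 ≤ (Σ_{l<k₃} KL k₃ (m+1) l·(1 − Σ_{l'<k₃} KL k₃ (m+2+l) l'))·(1 − (1−θ_{k₃}(m;1)) − (1−θ_{k₃}(m;1))·KL k₃ m 0)`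
into the monotonicity of the truncation surpluses `SA (k₂+1) 1_{[0,j]}` below the edge — the second member of `hM1top` in §2.  Census g77: (S-f) log-ratio
`−0.2 … −0.96` on every benchmark three-age flow (`k₃ ≤ 128`, four damping classes). [folklore] -/
theorem flow_M1_top_of_crit (hmono : ∀ u v : ℕ → ℝ, SeqBox γ u → SeqBox γ v → (∀ j, u j ≤ v j) → B u ≤ B v)
    (hL : ∀ k, 0 ≤ L k) (hb : 0 < b) (hlo : ∀ u, SeqBox γ u → b ≤ B u) (hdom : ∀ u, SeqBox γ u → ∑ k ∈ range K, L k * u k ≤ B u)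
    (hh : SeqBox γ h) (hf : MemFlow B gIR h) (hg : ∀ t, 0 < g t ∧ g t ≤ 1)
    {k₂ k₃ : ℕ} (hk2 : 2 ≤ k₂) (hk23 : k₂ < k₃) (hKk : K = k₃ + 1) (hL3 : ∀ j, j < K → j ≠ 1 → j ≠ k₂ → j ≠ k₃ → L j = 0) {N : ℕ} (hKN : K ≤ N)
    (hKL : ∀ k n l, KL k n l = if 0 < k ∧ k < K ∧ l < k then L k * h (n + k) ^ 3 / 2 * ∏ t ∈ Ico (n + 1 + l) (n + k + 1), g t else 0)
    {θ : ℕ → ℕ → ℕ → ℝ} (hθ : ∀ k n l, θ k n l = 1 - (h (n + k + l) / h (n + k)) ^ 3 * ∏ t ∈ Ico (n + k + 1) (n + k + l + 1), g t)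
    {KA : ℕ → ℕ → ℕ → ℝ} {RL RA SL SA : ℕ → (ℕ → ℝ) → ℕ → ℝ}
    (hRL : ∀ i v m, RL i v m = ∑ l ∈ range K, KL i m l * v (m + 1 + l))
    (hRA : ∀ i v m, RA i v m = ∑ l ∈ range K, KA i m l * v (m + 1 + l))
    (hKA : ∀ i m l, KA i m l = KL i m l + KA (i + 1) m l) (hKAtop : ∀ m l, KA K m l = 0)
    (hSL : ∀ i (w : ℕ → ℝ), (∀ m, N < m → w m = 0) → (∀ m, N < m → SL i w m = 0) ∧ ∀ m, SL i w m = w m - RL i (SL i w) m)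
    (hSA : ∀ i (w : ℕ → ℝ), (∀ m, N < m → w m = 0) → (∀ m, N < m → SA i w m = 0) ∧ ∀ m, SA i w m = w m - RA i (SA i w) m)
    (hSf : ∀ m, KL k₃ (m + 1) (k₃ - 1) - (1 - θ k₃ m 1) * KL k₃ m 0 ≤
      (∑ l ∈ range k₃, KL k₃ (m + 1) l * (1 - ∑ l' ∈ range k₃, KL k₃ (m + 2 + l) l')) * (1 - (1 - θ k₃ m 1) - (1 - θ k₃ m 1) * KL k₃ m 0)) :
    ∀ j, j ≤ N → ∀ m, m < j →
      SA (k₂ + 1) (fun m => if m ≤ j then (1:ℝ) else 0) m ≤ SA (k₂ + 1) (fun m => if m ≤ j then (1:ℝ) else 0) (m + 1) := by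
  have hh0 : ∀ n, 0 < h n := fun n => (hh n).1
  have hanti := (strictAnti_of_memFlow hb hlo hh hf).antitone
  have hKL0 := weight_nonneg hL hh0 hg hKL
  have hKLK : ∀ i m l, K ≤ l + 1 → KL i m l = 0 := fun i m l hl => by rw [hKL, if_neg (by omega)]
  -- the aggregate above the middle age is the oldest kernel
  have hKA3 : ∀ m l, KA (k₂ + 1) m l = KL k₃ m l := by
    intro m l
    have h := aggregate_eq_sum (n := K - 1) hKA (fun m l => by rw [Nat.sub_add_cancel (by omega : 1 ≤ K)]; exact hKAtop m l)
      (show k₂ + 1 ≤ K - 1 + 1 by omega) m l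
    rw [h, sum_eq_single_of_mem k₃ (mem_Ico.mpr ⟨by omega, by omega⟩) fun k hk hk3 => ?_]
    obtain ⟨hk1, hk2⟩ := mem_Ico.mp hk
    exact kernel_zero hKL (hL3 k (by omega) (by omega) (by omega) hk3) m l
  -- reads on `range N`
  have hRL' : ∀ i v m, RL i v m = ∑ l ∈ range N, KL i m l * v (m + 1 + l) := fun i v m => by
    rw [hRL]; exact sum_range_of_le hKN fun l hl => by rw [hKLK i m l (by omega), zero_mul]
  -- MONO″ of the oldest age's truncation drops on the horizon `N` ((E83a) with (E83b)'s flow facts)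
  have hmono2 := mono2_top_of_onelag (N := N) (n := k₃) (y := k₃) hRL' hKL0 hSL (fun m l hl => hKLK k₃ m l (by omega)) (by omega) (by omega)
    (σ := fun m => 1 - θ k₃ m 1) (fun m l hl => flow_onelag_structure hh hKL hθ k₃ m l hl) (fun m => flow_sigma_mem hh hanti hg hθ k₃ m)
    (fun m => flow_onelag_decay hmono hL hb hlo hdom hh hf hg hKL hθ k₃ m)
    (fun j _ m => flow_trunc_key hmono hL hb hlo hdom hh hf hg hKL hRL k₃ j m)
    (fun m _ => by
      have e : ∀ l, ∑ l' ∈ range N, KL k₃ (m + 2 + l) l' = ∑ l' ∈ range k₃, KL k₃ (m + 2 + l) l' := fun l =>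
        (sum_range_of_le (show k₃ ≤ N by omega) fun l' hl' => hKLK k₃ (m + 2 + l) l' (by omega)).symm
      simp_rw [e]; exact hSf m)
  -- the surplus of the ages above `k₂` is the lone solve of the oldest kernel
  intro j hj m hmj
  obtain ⟨_, _, het⟩ := truncation_admissible (N := N) hj
  have hRAeq : ∀ v m, RA (k₂ + 1) v m = RL k₃ v m := fun v m => by
    rw [hRA, hRL]; exact sum_congr rfl fun l _ => by rw [hKA3]
  have heq : ∀ m, SA (k₂ + 1) (fun m => if m ≤ j then (1:ℝ) else 0) m = SL k₃ (fun m => if m ≤ j then (1:ℝ) else 0) m :=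
    sol_unique (hRL' k₃) (hSA _ _ het).1 (fun m => by rw [← hRAeq]; exact (hSA _ _ het).2 m) (hSL _ _ het).1 (hSL _ _ het).2
  have h1 := (hSL k₃ _ het).2 m
  have h2 := (hSL k₃ _ het).2 (m + 1)
  rw [heq, heq, h1, h2, if_pos (by omega), if_pos (by omega)]
  linarith [hmono2 j hj m]

/-! ## §4 The three-age socket on STATIC families only -/

/-- **THE THREE-AGE SOCKET v3 — STATIC FAMILIES ONLY.**  As §2 `flow_nonneg_three_ages_entering_horizon` with the top option `hM1top` replaced by
`hM1top'` = (S-c♯) above `k₂` ∨ **(S-f) for the oldest age** (§3 `flow_M1_top_of_crit`).  Every displayed disjunction now has, as its second member, a STATIC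
kernel family with a k-uniform margin in the generation-77 census: (S-d), (S-e″), (S-h), (S-f). [folklore] -/
theorem flow_nonneg_three_ages_entering_static (hmono : ∀ u v : ℕ → ℝ, SeqBox γ u → SeqBox γ v → (∀ j, u j ≤ v j) → B u ≤ B v)
    (hL : ∀ k, 0 ≤ L k) (hb : 0 < b) (hlo : ∀ u, SeqBox γ u → b ≤ B u) (hdom : ∀ u, SeqBox γ u → ∑ k ∈ range K, L k * u k ≤ B u)
    (hh : SeqBox γ h) (hf : MemFlow B gIR h)
    (hg : ∀ t, 0 < g t ∧ g t ≤ 1) (hgF : ∀ t, 1 / (1 + ∑ k ∈ range K, L k * h (t + k) ^ 3 / 2) ≤ g t)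
    {k₂ k₃ : ℕ} (hk2 : 2 ≤ k₂) (hk23 : k₂ < k₃) (hKk : K = k₃ + 1) (hL3 : ∀ j, j < K → j ≠ 1 → j ≠ k₂ → j ≠ k₃ → L j = 0) {N : ℕ} (hKN : K ≤ N)
    (hKL : ∀ k n l, KL k n l = if 0 < k ∧ k < K ∧ l < k then L k * h (n + k) ^ 3 / 2 * ∏ t ∈ Ico (n + 1 + l) (n + k + 1), g t else 0)
    {θ : ℕ → ℕ → ℕ → ℝ} (hθ : ∀ k n l, θ k n l = 1 - (h (n + k + l) / h (n + k)) ^ 3 * ∏ t ∈ Ico (n + k + 1) (n + k + l + 1), g t)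
    {KA : ℕ → ℕ → ℕ → ℝ} {RL RA SL SA : ℕ → (ℕ → ℝ) → ℕ → ℝ}
    (hRL : ∀ i v m, RL i v m = ∑ l ∈ range K, KL i m l * v (m + 1 + l))
    (hRA : ∀ i v m, RA i v m = ∑ l ∈ range K, KA i m l * v (m + 1 + l))
    (hKA : ∀ i m l, KA i m l = KL i m l + KA (i + 1) m l) (hKAtop : ∀ m l, KA K m l = 0)
    (hSL : ∀ i (w : ℕ → ℝ), (∀ m, N < m → w m = 0) → (∀ m, N < m → SL i w m = 0) ∧ ∀ m, SL i w m = w m - RL i (SL i w) m)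
    (hSA : ∀ i (w : ℕ → ℝ), (∀ m, N < m → w m = 0) → (∀ m, N < m → SA i w m = 0) ∧ ∀ m, SA i w m = w m - RA i (SA i w) m)
    {ρ : ℕ → ℕ → ℝ} {β : ℕ → ℕ → ℕ → ℝ}
    (hρ : ∀ i n, 1 ≤ i → i ≤ K - 1 → ρ i n = (∑ l ∈ range K, KL i n l) * (1 + ∑ k ∈ Ioc i (K - 1), θ k n i * β (i + 1) n k) /
      (1 - ∑ k ∈ Ioc i (K - 1), ∑ l ∈ range i, KL k n l))
    (hβnew : ∀ i n, 1 ≤ i → i ≤ K - 1 → β i n i = ρ i n / (1 - ρ i n))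
    (hβold : ∀ i n k, 1 ≤ i → i < k → k ≤ K - 1 → β i n k = β (i + 1) n k / (1 - ρ i n))
    {Hg : ℕ → ℕ → ℝ} (hH : ∀ i m, Hg i m = (1 + ∑ k ∈ Ioc i (K - 1), θ k m 1 * β (i + 1) m k) / (1 - ∑ k ∈ Ioc i (K - 1), KL k m 0))
    {AL : ℕ → ℕ → ℕ → ℝ} (hAL : ∀ i j p, AL i j p = ∑ l ∈ range i, if p + 1 + l ≤ j then KL i p l * (1 - ρ i (p + 1 + l)) else 0)
    {M : ℕ → ℕ → ℝ} (hM : ∀ i m, M i m = KL i m 0 + ∑ l ∈ range (K - 1), max (KL i m (l + 1) - KL i (m + 1) l) 0)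
    {HgS : ℕ → ℕ → ℕ → ℝ} (hHS : ∀ i j m, HgS i j m = (1 + ∑ k ∈ Ioc i (K - 1), θ k m 1 * β (i + 1) m k) /
      (1 - ∑ k ∈ Ioc i (K - 1), (KL k m 0 - if m + 1 + k ≤ j then KL k (m + 1) (k - 1) else 0)))
    (hSb1 : ∀ m, (1 + M 1 m) * (Hg 1 (m + 1) * KL 1 (m + 1) 0) ≤ KL 1 m 0)
    (hpair12 : (∀ n, ∑ l ∈ range k₂, KL k₂ (n + 1) l ≤ ∑ l ∈ range k₂, KL k₂ n l) ∨
      (∀ m, KL k₂ (m + 1) (k₂ - 1) * KL 1 (m + 1 + k₂) 0 * ∏ p ∈ Ico (m + 2) (m + 2 + k₂), Hg 1 p ≤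
        KL k₂ m 0 * KL 1 (m + 1) 0 * (1 - KL 1 (m + 2) 0 * Hg 1 (m + 2))))
    (hpair13 : (∀ n, ∑ l ∈ range k₃, KL k₃ (n + 1) l ≤ ∑ l ∈ range k₃, KL k₃ n l) ∨
      (∀ m, KL k₃ (m + 1) (k₃ - 1) * KL 1 (m + 1 + k₃) 0 * ∏ p ∈ Ico (m + 2) (m + 2 + k₃), Hg 1 p ≤
        KL k₃ m 0 * KL 1 (m + 1) 0 * (1 - KL 1 (m + 2) 0 * Hg 1 (m + 2))))
    (hlev2 : ((∀ m L', L' < k₂ → (1 + M k₂ m) * ∑ l ∈ Ico L' k₂, Hg k₂ (m + 1 + l) * KL k₂ (m + 1) l ≤ ∑ l ∈ Ico L' k₂, KL k₂ m l) ∧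
        (∀ m L₀, L₀ < k₂ → ∀ L', L' ≤ L₀ → (1 + M k₂ m) * ∑ l ∈ Ico L' L₀, Hg k₂ (m + 1 + l) * KL k₂ (m + 1) l ≤ ∑ l ∈ Ico L' (L₀ + 1), KL k₂ m l)) ∨
      (∀ m, KL k₂ (m + 1) (k₂ - 1) ≤ (1 - (1 - θ k₂ m 1)) * ∑ l ∈ range k₂, KL k₂ m l * (1 - ρ k₂ (m + 1 + l)) / ∏ p ∈ Ico (m + 1 + l) (m + 1 + k₂), Hg k₂ p +
        (1 - θ k₂ m 1) * (KL k₂ m 0 * (1 - ρ k₂ (m + 1)) / ∏ p ∈ Ico (m + 1) (m + 1 + k₂), Hg k₂ p)))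
    (hpair23 : (∀ n, ∑ l ∈ range k₃, KL k₃ (n + 1) l ≤ ∑ l ∈ range k₃, KL k₃ n l) ∨
      (∀ j m, m + 1 + k₃ ≤ j →
        KL k₃ (m + 1) (k₃ - 1) * ∑ l ∈ range k₂, KL k₂ (m + 1 + k₃) l * ∏ s ∈ Ico (m + 2) (m + 2 + k₃ + l), Hg k₂ s ≤
          (1 - (1 - θ k₃ m 1)) * ∑ l' ∈ range k₃, KL k₃ m l' * AL k₂ j (m + 1 + l') + (1 - θ k₃ m 1) * (KL k₃ m 0 * AL k₂ j (m + 1))))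
    (hM1top' : ((∀ m j, m + 1 + N ≤ j → ∀ L', L' < N →
          ∑ l ∈ Ico L' N, HgS k₂ j (m + 1 + l) * KA (k₂ + 1) (m + 1) l ≤ ∑ l ∈ Ico L' N, KA (k₂ + 1) m l) ∧
        (∀ m L₀, L₀ < N → ∀ L', L' ≤ L₀ →
          ∑ l ∈ Ico L' L₀, HgS k₂ (m + 1 + L₀) (m + 1 + l) * KA (k₂ + 1) (m + 1) l ≤ ∑ l ∈ Ico L' (L₀ + 1), KA (k₂ + 1) m l)) ∨
      (∀ m, KL k₃ (m + 1) (k₃ - 1) - (1 - θ k₃ m 1) * KL k₃ m 0 ≤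
        (∑ l ∈ range k₃, KL k₃ (m + 1) l * (1 - ∑ l' ∈ range k₃, KL k₃ (m + 2 + l) l')) * (1 - (1 - θ k₃ m 1) - (1 - θ k₃ m 1) * KL k₃ m 0)))
    {e ε : ℕ → ℝ} (he0 : ∀ m, 0 ≤ e m) (hea : ∀ m, e (m + 1) ≤ e m) (het : ∀ m, N < m → e m = 0)
    (hεt : ∀ m, N < m → ε m = 0) (hεrec : ∀ m, ε m = e m - RA 1 ε m) : ∀ m, 0 ≤ ε m :=
  flow_nonneg_three_ages_entering_horizon hmono hL hb hlo hdom hh hf hg hgF hk2 hk23 hKk hL3 hKN hKL hθ hRL hRA hKA hKAtop hSL hSA hρ hβnew hβold hH hAL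
    hM hHS hSb1 hpair12 hpair13 hlev2 hpair23
    (hM1top'.imp_right fun hSf => flow_M1_top_of_crit hmono hL hb hlo hdom hh hf hg hk2 hk23 hKk hL3 hKN hKL hθ hRL hRA hKA hKAtop hSL hSA hSf)
    he0 hea het hεt hεrec

end Summit.QuantumFields.BalabanUV.Beta.EriceRemainderEnclosureHistoryAutonomyComparisonAgeCompositionThreeAgesEntering

end
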